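import Summits.QuantumFields.BalabanUV.Beta.GAN24.DirichletVertexNear
import Summits.QuantumFields.BalabanUV.Beta.GAN24.DirichletVertexFlux

/-!
# `BalabanUV.Beta.GAN24.DirichletVertexFluxU` — binder row G-an2-4 / (CONV-C), road P2 PART IV, leaf L14 (the torus transfer), FILE U3:
# THE FLUX BINDERS (Φ) AND (Φ′) WITH VOLUME-FREE CONSTANTS — the ray schedule with `ρ₂ = (5/n)·ω_V` (unit b2b-balaban-gan24-p2, gen 27, v1;
# the volume-uniform twin of `DirichletVertexFlux` p246955, whose `ρ₂ = ((1+|V|)/n)·ω_V` carried the cardinality of the family)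

HONEST FRAMING (cell contract, verbatim): «discharging `BetaPertH` makes Bałaban's UV stability UNCONDITIONAL — a real constructive-QFT
result; it is NOT the continuum limit and NOT the Clay problem.»  SUPPLIER module under the T⁴-DAG sub-row `T4-U1a.S-NE2-D1-DIRICHLET°`
(owner wording R24 «the full rate L⁻¹ beyond boxes OPEN»).  The weighted socket `DirichletBoxWeightedSockets.injected_le_of_weighted` (p234489)
displays the flux binders (Φ) `Σ_μ nsq(bdryPart(∂_μ u_f)) ≤ φ‖f‖²` (coarse) and (Φ′) `Σ_μ Σ_{x∉Ω′}|∂′ᴴ_μ∂′_μ v_w|² ≤ φ′‖w‖²` (fine).  The weighted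
trace bounds of `DirichletBoxWeightedTraces` (p236313) reduce both to weighted one-level sums, GIVEN a ray schedule.  THIS FILE supplies the
schedule, for `Ω = blockReg n M S` (d = 2) and the coarse weight `ω_V` of `DirichletVertexEnergy` (p244737), V ANY finite family of vertices:
`ℓ(y) = max(1, ⌊r_V(y)/4⌋)`, `ρ₁ = (18/n)·ω_V⁻¹`, `ρ₂ = (5/n)·ω_V` — for a family `V` with ONE ORIENTATION PER VERTEX (e.g. the re-entrant
ones) the four ray inequalities follow from `n/r_V ≤ ω_V⁻¹ ≤ 5·n/r_V` (`DirichletVertexNear`, at most four vertex windows meet at a site) and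
the 1-Lipschitz property of `r_V` — and derives, for EVERY `u` vanishing off `Ω`: (Φ)_field
`Σ_μ nsq(bdryPart(∂_μu)) ≤ (36/n)·Σ_μΣ_y ω_V⁻¹|∂_μu|² + (10/n)·Σ_μΣ_{x∈Ω} ω_V|∂ᴴ_μ∂_μu|²`, and at a refined level `n′ = R·N`: (Φ′)_field
`Σ_μ Σ_{x∉Ω′}|∂′ᴴ_μ∂′_μv|² ≤ 4n′·(18·Σ_μΣ ω⁻¹|∂′_μv|² + 5·Σ_μΣ_{Ω′} ω|∂′ᴴ_μ∂′_μv|²)` — NO cardinality of `V` anywhere.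

## Contents ([folklore]; 0 sorry)
* §1 `rho2`, `schedule_two` (with `ell`, `rho1`, `schedule_one` of p246955); **`flux_le`**: forward + backward flux of direction `μ`
  `≤ (36/n)·Σ_x ω⁻¹|∂_μu|² + (10/n)·Σ_{x∈Ω} ω|∂ᴴ_μ∂_μu|²`.
* §2 **`bdry_sum_le`** = (Φ)_field; §3 **`exterior_sum_le`** = (Φ′)_field at level `R·N` (`exterior_le_fluxes` of p246955).

ABSOLUTE RULE (cell, verbatim): «No internally-minted statement may enter as a cited fact. Every hypothesis is either kernel-proved in
this package or a verbatim quotation of a PUBLISHED theorem with page reference. The manuscript(s) under audit are NOT citable for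
their own disputed steps — they are the thing under adjudication; programme-internal (2001/route/tribunal) claims are never citable.»
Nothing printed is a hypothesis.  NOT CLAIMED: (A′)/(B) themselves, the END (p234489 stays CONDITIONAL); NOT NE2, (CONV-C), `BetaPertH`,
continuum, Clay.  «not in print; our proof attempt».  HONEST DEPENDENCY: continuum YM on T⁴ ⇐ BetaPertH ∧ nine spine estimates (0/9
proved); BetaPertH ⇐ (D1) ∧ (D4) ∧ CAP+tail; G-an2-4 gates asym, D1 and NE2/3/4.
-/

noncomputable section

open scoped BigOperators ComplexConjugate Matrix
open Finset

namespace Summit.QuantumFields.BalabanUV.Beta.GAN24.DirichletVertexFluxU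

open Literature.MathematicalPhysics.QuantumFieldTheory.Balaban1983to89.B5Prop11Plancherel (Tor fine unitVec)
open Literature.MathematicalPhysics.QuantumFieldTheory.Balaban1983to89.B5Action121 (sdiff)
open Literature.MathematicalPhysics.QuantumFieldTheory.Balaban1983to89.B5Prop11Lower (nsq nsq_nonneg)
open Literature.MathematicalPhysics.QuantumFieldTheory.Balaban1983to89.B5Block118 (tstep)
open Summit.QuantumFields.BalabanUV.Beta.GAN24.DirichletBoxRegularity (Pdir)
open Summit.QuantumFields.BalabanUV.Beta.GAN24.DirichletBoxTrace (blockReg)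
open Summit.QuantumFields.BalabanUV.Beta.GAN24.DirichletBoxTwoLevelCore (bdryPart normSq_exterior_density_le)
open Summit.QuantumFields.BalabanUV.Beta.GAN24.DirichletBoxWeightedTraces (trace_fwd_sum_le_weighted trace_bwd_sum_le_weighted
  nsq_bdryPart_le_fluxes)
open DirichletVertexEnergy (omegaV omegaV_pos omegaV_le_one)
open DirichletVertexDistV (rV rV_le_n one_le_rV rV_add_tstep_le rV_sub_tstep_le rV_sub_unitVec_le le_inv_omegaV)
open DirichletVertexNear (le_omegaV_five)
open DirichletVertexFlux (ell rho1 one_le_ell ell_le_n rho1_nonneg schedule_one exterior_le_fluxes)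

variable (n : ℕ) [NeZero n] (M : Fin 2 → ℕ) [hM : ∀ μ, NeZero (M μ)] (V : Finset ((Fin 2 → Bool) × Tor M))

/-! ## §1 The schedule -/

/-- the weight on the second differences `ρ₂ = (5/n)·ω_V`. [folklore] -/
def rho2 (x : Tor (fine n M)) : ℝ := 5 / (n : ℝ) * omegaV n M V (n - 1) x

omit [NeZero n] hM in
/-- `0 ≤ ρ₂`. [folklore] -/
theorem rho2_nonneg (x : Tor (fine n M)) : 0 ≤ rho2 n M V x := by
  have := omegaV_pos n M V (n - 1) x
  unfold rho2; positivity

/-- **schedule, second differences**: if `2 ≤ ℓ(y)` and `r_V(y) ≤ r_V(x) + (ℓ(y) − 2)` then `2ℓ(y)/n² ≤ ρ₂(x)` (`2 ≤ n`, `M_ν ≥ 2`, one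
orientation per vertex in `V`). [folklore] -/
theorem schedule_two (hinj : ∀ v ∈ V, ∀ v' ∈ V, v.2 = v'.2 → v = v') (hn : 2 ≤ n) (hM2 : ∀ ν, 2 ≤ M ν) {y x : Tor (fine n M)}
    (hℓ : 2 ≤ ell n M V y) (h : rV n M V y ≤ rV n M V x + (ell n M V y - 2)) : 2 * (ell n M V y : ℝ) / (n : ℝ) ^ 2 ≤ rho2 n M V x := by
  have hn0 : (0 : ℝ) < n := by exact_mod_cast Nat.pos_of_ne_zero (NeZero.ne n)
  have hint : 2 * ell n M V y ≤ rV n M V x := by unfold ell at h hℓ ⊢; omega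
  have h1 : 2 * (ell n M V y : ℝ) / (n : ℝ) ^ 2 ≤ (rV n M V x : ℝ) / (n : ℝ) ^ 2 :=
    div_le_div_of_nonneg_right (by exact_mod_cast hint) (by positivity)
  have h2 : (rV n M V x : ℝ) / (n : ℝ) ^ 2 = 5 / (n : ℝ) * ((rV n M V x : ℝ) / (5 * n)) := by
    field_simp
  rw [rho2]
  calc _ ≤ _ := h1
    _ = _ := h2
    _ ≤ 5 / (n : ℝ) * omegaV n M V (n - 1) x := mul_le_mul_of_nonneg_left (le_omegaV_five n M V hinj hn hM2 x) (by positivity)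

variable (S : Tor M → Prop) [DecidablePred S]

/-- **THE FLUX OF ONE DIRECTION FROM WEIGHTED SUMS, VOLUME-FREE**: for `u` vanishing off `Ω = blockReg n M S` (`2 ≤ n`, `M_ν ≥ 2`, one
orientation per vertex in `V`), `Σ_{fwd bdry}‖n·u‖² + Σ_{bwd bdry}‖n·u‖² ≤ (36/n)·Σ_x ω_V⁻¹|(∂_μu)(x)|² + (10/n)·Σ_{x∈Ω} ω_V|(∂ᴴ_μ∂_μu)(x)|²`.
[folklore] -/
theorem flux_le (hinj : ∀ v ∈ V, ∀ v' ∈ V, v.2 = v'.2 → v = v') (hn : 2 ≤ n) (hM2 : ∀ ν, 2 ≤ M ν) (μ : Fin 2)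
    {u : Tor (fine n M) → ℂ} (hu : ∀ x, ¬ blockReg n M S x → u x = 0) :
    ∑ y ∈ univ.filter (fun y : Tor (fine n M) => blockReg n M S y ∧ ¬ blockReg n M S (y - unitVec (fine n M) μ)), ‖(n : ℂ) * u y‖ ^ 2
      + ∑ y ∈ univ.filter (fun y : Tor (fine n M) => blockReg n M S y ∧ ¬ blockReg n M S (y + unitVec (fine n M) μ)), ‖(n : ℂ) * u y‖ ^ 2
      ≤ 36 / (n : ℝ) * ∑ x, (omegaV n M V (n - 1) x)⁻¹ * ‖(sdiff (fine n M) (n : ℂ) μ *ᵥ u) x‖ ^ 2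
        + 10 / (n : ℝ) * ∑ x ∈ univ.filter (blockReg n M S), omegaV n M V (n - 1) x * ‖(Pdir (fine n M) (n : ℂ) μ *ᵥ u) x‖ ^ 2 := by
  -- the schedule hypotheses
  have hf₁ : ∀ y, blockReg n M S y → ¬ blockReg n M S (y - unitVec (fine n M) μ) → ∀ j, j < ell n M V y →
      2 / (ell n M V y : ℝ) ≤ rho1 n M V (y - unitVec (fine n M) μ + tstep (fine n M) μ j) := by
    intro y _ _ j hj
    refine schedule_one n M V ?_
    have h1 := (rV_sub_unitVec_le n M V μ y).1
    have h2 := (rV_add_tstep_le n M V μ (y - unitVec (fine n M) μ) j).1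
    omega
  have hf₂ : ∀ y, blockReg n M S y → ¬ blockReg n M S (y - unitVec (fine n M) μ) → ∀ i, i + 1 < ell n M V y →
      2 * (ell n M V y : ℝ) / (n : ℝ) ^ 2 ≤ rho2 n M V (y + tstep (fine n M) μ i) := by
    intro y _ _ i hi
    refine schedule_two n M V hinj hn hM2 (by omega) ?_
    have h2 := (rV_add_tstep_le n M V μ y i).2
    omega
  have hb₁ : ∀ y, blockReg n M S y → ¬ blockReg n M S (y + unitVec (fine n M) μ) → ∀ j, j < ell n M V y →
      2 / (ell n M V y : ℝ) ≤ rho1 n M V (y - tstep (fine n M) μ j) := by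
    intro y _ _ j hj
    refine schedule_one n M V ?_
    have h2 := (rV_sub_tstep_le n M V μ y j).1
    omega
  have hb₂ : ∀ y, blockReg n M S y → ¬ blockReg n M S (y + unitVec (fine n M) μ) → ∀ i, i + 1 < ell n M V y →
      2 * (ell n M V y : ℝ) / (n : ℝ) ^ 2 ≤ rho2 n M V (y - tstep (fine n M) μ i) := by
    intro y _ _ i hi
    refine schedule_two n M V hinj hn hM2 (by omega) ?_
    have h2 := (rV_sub_tstep_le n M V μ y i).2
    omega
  have hF := trace_fwd_sum_le_weighted n M S μ u hu (ell n M V) (one_le_ell n M V) (ell_le_n n M V) (rho1 n M V) (rho2 n M V)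
    (rho1_nonneg n M V) (rho2_nonneg n M V) hf₁ hf₂
  have hB := trace_bwd_sum_le_weighted n M S μ u hu (ell n M V) (one_le_ell n M V) (ell_le_n n M V) (rho1 n M V) (rho2 n M V)
    (rho1_nonneg n M V) (rho2_nonneg n M V) hb₁ hb₂
  -- the weighted sums
  have e1 : ∑ x, rho1 n M V x * ‖(sdiff (fine n M) (n : ℂ) μ *ᵥ u) x‖ ^ 2
      = 18 / (n : ℝ) * ∑ x, (omegaV n M V (n - 1) x)⁻¹ * ‖(sdiff (fine n M) (n : ℂ) μ *ᵥ u) x‖ ^ 2 := by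
    rw [mul_sum]; refine sum_congr rfl fun x _ => ?_; rw [rho1]; ring
  have e2 : ∑ x ∈ univ.filter (blockReg n M S), rho2 n M V x * ‖(Pdir (fine n M) (n : ℂ) μ *ᵥ u) x‖ ^ 2
      = 5 / (n : ℝ) * ∑ x ∈ univ.filter (blockReg n M S), omegaV n M V (n - 1) x * ‖(Pdir (fine n M) (n : ℂ) μ *ᵥ u) x‖ ^ 2 := by
    rw [mul_sum]; refine sum_congr rfl fun x _ => ?_; rw [rho2]; ring
  rw [e1, e2] at hF hB
  have e3 : 36 / (n : ℝ) * ∑ x, (omegaV n M V (n - 1) x)⁻¹ * ‖(sdiff (fine n M) (n : ℂ) μ *ᵥ u) x‖ ^ 2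
      + 10 / (n : ℝ) * ∑ x ∈ univ.filter (blockReg n M S), omegaV n M V (n - 1) x * ‖(Pdir (fine n M) (n : ℂ) μ *ᵥ u) x‖ ^ 2
      = 2 * (18 / (n : ℝ) * ∑ x, (omegaV n M V (n - 1) x)⁻¹ * ‖(sdiff (fine n M) (n : ℂ) μ *ᵥ u) x‖ ^ 2
        + 5 / (n : ℝ) * ∑ x ∈ univ.filter (blockReg n M S), omegaV n M V (n - 1) x * ‖(Pdir (fine n M) (n : ℂ) μ *ᵥ u) x‖ ^ 2) := by
    ring
  rw [e3]
  linarith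

/-! ## §2 The coarse flux binder (Φ), field form -/

/-- **(Φ), FIELD FORM, VOLUME-FREE**: for `u` vanishing off `Ω = blockReg n M S` (`2 ≤ n`, `M_ν ≥ 2`, one orientation per vertex),
`Σ_μ nsq(bdryPart(∂_μu)) ≤ (36/n)·Σ_μ Σ_y ω_V⁻¹|∂_μu|² + (10/n)·Σ_μ Σ_{x∈Ω} ω_V|∂ᴴ_μ∂_μu|²`. [folklore] -/
theorem bdry_sum_le (hinj : ∀ v ∈ V, ∀ v' ∈ V, v.2 = v'.2 → v = v') (hn : 2 ≤ n) (hM2 : ∀ ν, 2 ≤ M ν) {u : Tor (fine n M) → ℂ}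
    (hu : ∀ x, ¬ blockReg n M S x → u x = 0) :
    ∑ μ, nsq (bdryPart n M (blockReg n M S) μ (sdiff (fine n M) (n : ℂ) μ *ᵥ u))
      ≤ 36 / (n : ℝ) * ∑ μ, ∑ x, (omegaV n M V (n - 1) x)⁻¹ * ‖(sdiff (fine n M) (n : ℂ) μ *ᵥ u) x‖ ^ 2
        + 10 / (n : ℝ) *
          ∑ μ, ∑ x ∈ univ.filter (blockReg n M S), omegaV n M V (n - 1) x * ‖(Pdir (fine n M) (n : ℂ) μ *ᵥ u) x‖ ^ 2 := by
  rw [mul_sum, mul_sum, ← sum_add_distrib]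
  refine sum_le_sum fun μ _ => ?_
  have h0 := nsq_bdryPart_le_fluxes n M S μ hu
  have h1 := flux_le n M V S hinj hn hM2 μ hu
  exact h0.trans ((add_comm _ _).le.trans h1)

/-! ## §3 The fine flux binder (Φ′), field form, at a refined level `R·N` -/

section Fine

variable (N R : ℕ) [NeZero N] [NeZero R]

/-- **(Φ′), FIELD FORM, VOLUME-FREE, at the refined level `n′ = R·N`**: for `v` vanishing off `Ω′` (`2 ≤ RN`, `M_ν ≥ 2`, one
orientation per vertex) and the weight `ω′_V` of level `RN`:
`Σ_μ Σ_{x∉Ω′}|∂′ᴴ_μ∂′_μv|² ≤ 4RN·(18·Σ_μΣ_x ω′_V⁻¹|∂′_μv|² + 5·Σ_μΣ_{x∈Ω′} ω′_V|∂′ᴴ_μ∂′_μv|²)`. [folklore] -/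
theorem exterior_sum_le (hinj : ∀ v ∈ V, ∀ v' ∈ V, v.2 = v'.2 → v = v') (hn : 2 ≤ R * N) (hM2 : ∀ ν, 2 ≤ M ν)
    {v : Tor (fine (R * N) M) → ℂ} (hv : ∀ x, ¬ blockReg (R * N) M S x → v x = 0) :
    ∑ μ, ∑ x ∈ univ.filter (fun x => ¬ blockReg (R * N) M S x), ‖(Pdir (fine (R * N) M) ((R * N : ℕ) : ℂ) μ *ᵥ v) x‖ ^ 2
      ≤ 4 * ((R * N : ℕ) : ℝ) *
        (18 * ∑ μ, ∑ x, (omegaV (R * N) M V (R * N - 1) x)⁻¹ * ‖(sdiff (fine (R * N) M) ((R * N : ℕ) : ℂ) μ *ᵥ v) x‖ ^ 2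
          + 5 * ∑ μ, ∑ x ∈ univ.filter (blockReg (R * N) M S),
              omegaV (R * N) M V (R * N - 1) x * ‖(Pdir (fine (R * N) M) ((R * N : ℕ) : ℂ) μ *ᵥ v) x‖ ^ 2) := by
  have hc0 : (0 : ℝ) < ((R * N : ℕ) : ℝ) := by exact_mod_cast Nat.pos_of_ne_zero (NeZero.ne (R * N))
  set A : Fin 2 → ℝ := fun μ => ∑ x, (omegaV (R * N) M V (R * N - 1) x)⁻¹ * ‖(sdiff (fine (R * N) M) ((R * N : ℕ) : ℂ) μ *ᵥ v) x‖ ^ 2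
    with hA
  set B : Fin 2 → ℝ := fun μ => ∑ x ∈ univ.filter (blockReg (R * N) M S),
    omegaV (R * N) M V (R * N - 1) x * ‖(Pdir (fine (R * N) M) ((R * N : ℕ) : ℂ) μ *ᵥ v) x‖ ^ 2 with hB
  have hdir : ∀ μ, ∑ x ∈ univ.filter (fun x => ¬ blockReg (R * N) M S x), ‖(Pdir (fine (R * N) M) ((R * N : ℕ) : ℂ) μ *ᵥ v) x‖ ^ 2
      ≤ 4 * ((R * N : ℕ) : ℝ) * (18 * A μ + 5 * B μ) := by
    intro μ
    have h0 := exterior_le_fluxes M S N R μ hv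
    have h1 := flux_le (R * N) M V S hinj hn hM2 μ hv
    refine h0.trans ?_
    have e : 2 * ((R * N : ℕ) : ℝ) ^ 2 * (36 / ((R * N : ℕ) : ℝ) * A μ + 10 / ((R * N : ℕ) : ℝ) * B μ)
        = 4 * ((R * N : ℕ) : ℝ) * (18 * A μ + 5 * B μ) := by
      field_simp
      ring
    rw [← e]
    exact mul_le_mul_of_nonneg_left h1 (by positivity)
  calc _ ≤ ∑ μ, 4 * ((R * N : ℕ) : ℝ) * (18 * A μ + 5 * B μ) := sum_le_sum fun μ _ => hdir μ
    _ = 4 * ((R * N : ℕ) : ℝ) * (18 * ∑ μ, A μ + 5 * ∑ μ, B μ) := by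
        rw [Fin.sum_univ_two, Fin.sum_univ_two, Fin.sum_univ_two]; ring

end Fine

end Summit.QuantumFields.BalabanUV.Beta.GAN24.DirichletVertexFluxU

end
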